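import Summits.ABC.StewartYu.PadicG3ParB
import HarnessLib

/-!
# The ARCHIMEDEAN Gen-3 parameter record `ArchG3Par` (WP-L.A P-A8, cell abc-stewartyu, rung A1.L, crux r2 `ArchCoreRat`)

Support file (one structure, plain definitions, elementary theorems; no named facts). Seat p1 (record owner);
design of record HOME/p1/memo/ArchG3-START-design-g9.md («design B», plan R24(b)/R25) re-costed on the Taylor-normalised
Δ-basis k-step OF RECORD (R26, lp-1 `ArchG3KStepDelta.kstep_delta_symm/odd`); kit ledger HOME/p1/num/g10/arch_table.md
(j283629/631/633/640; this file carries NO budget line — those follow in `ArchG3ParA/…` once the ledger is posted, R26(d)).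

THE RECORD is the TRANSLITERATION of the `𝔑`-threaded p-adic v2 family (`PadicG3ParV` + `PadicG3ParN`) with the
archimedean dictionary of design B §3:
* the gain per zero is the FREE constant `G = c_G (n+1) = 8(n+1)`, realised by the radius ratio `E = e^G` of the
  Hermite/Cauchy extrapolation (no prime, no `θ₀`, no `m`, no excess gain: `g = 1`);
* Matveev's thin slab is replaced by `K = ⌈n·e^{G+2}⌉₊ + 1` PIGEONHOLE CLASSES of the exponent functional
  `λ ↦ Σ λⱼ log αⱼ` on the box (`Dioph.exists_slab_class`; slab half-width `L·e^{−G−2}`, so the growth term of the far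
  circle is `3e^{−2}·(2N+1)·L` per step) — the archimedean image of the p-adic class count `K = p^m(p−1)`;
* everything else is the v2/N family at `g = 1` verbatim: `Ω`, `W = log(eB)` (`W ≥ log N` threaded as in
  `PadicG3ParN`), depth `Ŝ = n + 24 + ⌊log₂(K·N)⌋`, `N`-free multiplicity/box scale
  `L = max(⌈24 C_bⁿ Ω K·yload_K/G⌉, 2^{n+25}, ⌈2Amax + 1⌉, 4(Ŝ+2))`, `M = 16(n+1)L`, `T s = max 1 (8L/2^s)`,
  `W_L`, `X = max(⌈64(n+1)W_L/G⌉, ⌈(3/2)(n+1)L/(C_bⁿΩK)⌉, 64(n+1))`, `X_s = ⌊2^s G X/(16(n+1))⌋ + 1`,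
  `L₀ = ⌈6X·C_bⁿΩK/N⌉` (Siegel over `𝔑`: the count `SatBox.card_satBox_ge`), `H`, the tail-sum orders `R/Mord`, and the
  END data `D₀, D j = ⌊K·N·L/(2^Ŝ Aⱼ)⌋ + 1, X_fin, S₀` (`K·N ↔ 2^Ŝ`), the unit `Z = G·X·L`, `zeros s ν = G(2^{ν+1}X_s)(T_s+1)`.
This file: the structure, the closed forms, the depth sandwich and the scale floors; the schedule laws and the
`Y₀`-degree facts are `ArchG3ParA`.

## References
* [Nesterenko2003] Yu. V. Nesterenko, *Linear forms in logarithms of rational numbers*, LNM 1819 (2003) — §3.3 Prop 3.4,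
  §3.5 (3.22)–(3.24), Prop 3.9, §4.1 Lemma 4.2 (radius ratio), (4.3)–(4.5), §5.2 (5.5)–(5.8).
* [Matveev2000] E. M. Matveev, Izv. Math. 64 (2000) — §3 (the slab).
-/

noncomputable section

open Finset Real

namespace Summit.ABC.StewartYu

/-- **The data of the archimedean Gen-3 record** (design B): `n ≥ 1` generators with plain heights
`log 2 ≤ A j ≤ Amax`, the coefficient logarithm `W ≥ 1` (`W ≥ log(eB)`, and `W ≥ log N`), and the saturation index
`N = [𝔑 : ℤⁿ] ≥ 1` with `N ≤ (2/log 2)ⁿ·Ω`. [cite: Nesterenko2003, §2 (2.3), §3.4 (3.16)] -/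
structure ArchG3Par (n : ℕ) where
  /-- plain heights of the generators -/
  A : Fin n → ℝ
  /-- a common bound of the heights (enters only logarithms) -/
  Amax : ℝ
  /-- the coefficient logarithm `W ≥ log(eB)` -/
  W : ℝ
  /-- the saturation index `N = [𝔑 : ℤⁿ]` -/
  N : ℕ
  hn : 1 ≤ n
  hA : ∀ j, Real.log 2 ≤ A j
  hAmax : ∀ j, A j ≤ Amax
  hAmax1 : 1 ≤ Amax
  hW : 1 ≤ W
  hN : 1 ≤ N
  hNΩ : (N : ℝ) ≤ (2 / Real.log 2) ^ n * ∏ j, A j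
  hNW : Real.log N ≤ W

namespace ArchG3Par

open PadicG3Par (cG cM Cb cG_pos Cb_pos)

variable {n : ℕ} (P : ArchG3Par n)

/-! ### The closed forms -/

/-- `Ω = ∏ A j`. [cite: Nesterenko2003, (2.3)] -/
def Ω : ℝ := ∏ j, P.A j

/-- the FREE gain per zero `G = c_G (n+1)` (realised by the radius ratio `e^G`). [cite: Nesterenko2003, §4.1 Lemma 4.2] -/
def G (n : ℕ) : ℝ := cG * (n + 1)

/-- the number of pigeonhole slab classes `K = ⌈n·e^{G+2}⌉₊ + 1`. [cite: Matveev2000, §3] -/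
def K (n : ℕ) : ℕ := ⌈(n : ℝ) * Real.exp (G n + 2)⌉₊ + 1

/-- the `N`-free depth `ŜK = n + 24 + ⌊log₂ K⌋`. [cite: Nesterenko2003, (3.24)] -/
def SdK (n : ℕ) : ℕ := n + 24 + Nat.log 2 (K n)

/-- the depth `Ŝ = n + 24 + ⌊log₂ (K·N)⌋`. [cite: Nesterenko2003, (3.24)] -/
def Sd : ℕ := n + 24 + Nat.log 2 (K n * P.N)

/-- the `N`-free `Y₀`-load `yloadK = 2G + (ŜK + n + 1) log 2 + log(n+1) + 8`. [folklore] -/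
def yloadK (n : ℕ) : ℝ := 2 * G n + (SdK n + n + 1) * Real.log 2 + Real.log (n + 1) + 8

/-- the true `Y₀`-load `yload = 2G + (Ŝ + n + 1) log 2 + log(n+1) + 8`. [folklore] -/
def yload : ℝ := 2 * G n + (P.Sd + n + 1) * Real.log 2 + Real.log (n + 1) + 8

/-- the multiplicity = box scale `L = max(⌈24 C_bⁿ Ω K·yloadK/G⌉, 2^{n+25}, ⌈2Amax+1⌉, 4(Ŝ+2))` (`N`-free main term).
[cite: Nesterenko2003, §3.5 (3.23)] -/
def L : ℕ :=
  max (max ⌈24 * Cb ^ n * P.Ω * K n * yloadK n / G n⌉₊ (2 ^ (n + 25))) (max ⌈2 * P.Amax + 1⌉₊ (4 * (P.Sd + 2)))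

/-- the total multiplicity `M = 16(n+1)L`. [cite: Nesterenko2003, Prop 3.9] -/
def M : ℕ := 16 * (n + 1) * P.L

/-- the decrement `T s = max 1 (8L/2^s)` — FLOORED at `1`. [cite: Nesterenko2003, (4.3)] -/
def T (s : ℕ) : ℕ := max 1 (8 * P.L / 2 ^ s)

/-- the size logarithm `W_L = log(e(1 + 2e^W L))`. [cite: Nesterenko2003, (3.37)] -/
def WL : ℝ := Real.log (Real.exp 1 * (1 + 2 * Real.exp P.W * P.L))

/-- the number of points `X = max(⌈64(n+1)W_L/G⌉, ⌈(3/2)(n+1)L/(C_bⁿΩK)⌉, 64(n+1))`. [cite: Nesterenko2003, Prop 3.9] -/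
def X : ℕ :=
  max (max ⌈64 * (n + 1) * P.WL / G n⌉₊ ⌈(3 / 2) * (n + 1) * P.L / (Cb ^ n * P.Ω * K n)⌉₊) (64 * (n + 1))

/-- the range at level `s`: `X_s = ⌊2^s G X/(16(n+1))⌋ + 1 ≍ 2^{s−1}X`. [cite: Nesterenko2003, (4.3)] -/
def Xs (s : ℕ) : ℕ := ⌊(2 : ℝ) ^ s * G n * P.X / (16 * (n + 1))⌋₊ + 1

/-- the `Y₀`-degree `L₀ = ⌈6 X C_bⁿ Ω K/N⌉` (Siegel over `𝔑`). [cite: Nesterenko2003, (3.23)] -/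
def L₀ : ℕ := ⌈6 * P.X * Cb ^ n * P.Ω * K n / P.N⌉₊

/-- the Feldman block `H = max 1 ⌊G X/(64(n+1))⌋`. [cite: Nesterenko2003, (3.23)] -/
def H : ℕ := max 1 ⌊G n * P.X / (64 * (n + 1))⌋₊

/-- remaining decrements `R s = Σ_{s' ∈ [s, Ŝ]} T s'`. [cite: Nesterenko2003, (4.5)] -/
def R (s : ℕ) : ℕ := ∑ s' ∈ Finset.Icc s P.Sd, P.T s'

/-- the order at stage `(s, ν)`: `Mord s ν = M/(n+2)³ + (n+1)·R(s+1) + (n+1−ν)·T s`. [cite: Nesterenko2003, (4.5)] -/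
def Mord (s ν : ℕ) : ℕ := P.M / (n + 2) ^ 3 + (n + 1) * P.R (s + 1) + (n + 1 - ν) * P.T s

/-- `D₀ = L₀ + 1`. [cite: Nesterenko2003, §5.2] -/
def D₀ : ℕ := P.L₀ + 1

/-- the END degrees `D j = ⌊K·N·L/(2^Ŝ A j)⌋ + 1`. [cite: Nesterenko2003, (5.5)] -/
def D (j : Fin n) : ℕ := ⌊(K n : ℝ) * P.N * P.L / (2 ^ P.Sd * P.A j)⌋₊ + 1

/-- the END range `X_fin = 2ⁿ X_Ŝ/(n+1)`. [cite: Nesterenko2003, §5.2 (5.12)] -/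
def Xfin : ℕ := 2 ^ n * P.Xs P.Sd / (n + 1)

/-- `S₀ = M/(n+2)⁴`. [cite: Nesterenko2003, (5.8)] -/
def S₀ : ℕ := P.M / (n + 2) ^ 4

/-- the unit `Z = G·(X·L)`. [folklore] -/
def Z : ℝ := G n * (P.X * P.L)

/-- the zeros gain at stage `(s, ν)`: `G·(2^{ν+1}X_s)·(T_s+1)`. [cite: Nesterenko2003, (4.25)] -/
def zeros (s ν : ℕ) : ℝ := G n * (2 ^ (ν + 1) * P.Xs s) * (P.T s + 1)

/-! ### Elementary facts: the data -/

/-- `0 < A j` for every `j` (as `A j ≥ log 2`). [folklore] -/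
theorem A_pos' : ∀ j, 0 < P.A j := fun j => by have := P.hA j; have := Real.log_two_gt_d9; linarith

/-- `0 < Ω`. [folklore] -/
theorem Ω_pos : 0 < P.Ω := Finset.prod_pos fun j _ => P.A_pos' j

/-- `1 ≤ N` and `0 < N` (real). [folklore] -/
theorem N_real_facts : (1 : ℝ) ≤ P.N ∧ (0 : ℝ) < P.N := by
  have h : (1 : ℝ) ≤ P.N := by exact_mod_cast P.hN
  exact ⟨h, lt_of_lt_of_le one_pos h⟩

/-- **`G = 8(n+1)`.** [folklore] -/
theorem G_eq (n : ℕ) : G n = 8 * (n + 1) := by unfold G cG; ring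

/-- `8 ≤ G`. [folklore] -/
theorem eight_le_G (n : ℕ) : 8 ≤ G n := by
  rw [G_eq]; have : (0 : ℝ) ≤ n := Nat.cast_nonneg n
  linarith

/-- `16 ≤ G` (as `n ≥ 1`). [folklore] -/
theorem sixteen_le_G (P : ArchG3Par n) : 16 ≤ G n := by
  rw [G_eq]; have : (1 : ℝ) ≤ n := by exact_mod_cast P.hn
  linarith

/-- `0 < G`. [folklore] -/
theorem G_pos (n : ℕ) : 0 < G n := by linarith [eight_le_G n]

/-- `1 ≤ K`. [folklore] -/
theorem one_le_K (n : ℕ) : 1 ≤ K n := by unfold K; omega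

/-- `0 < K` (real). [folklore] -/
theorem K_pos (n : ℕ) : (0 : ℝ) < K n := by exact_mod_cast one_le_K n

/-- **`n·e^{G+2} ≤ K`** (there are enough classes for the slab width `L·e^{−G−2}`). [cite: Matveev2000, §3] -/
theorem mul_exp_le_K (n : ℕ) : (n : ℝ) * Real.exp (G n + 2) ≤ K n := by
  unfold K; push_cast
  have := Nat.le_ceil ((n : ℝ) * Real.exp (G n + 2))
  linarith

/-- `K ≤ n·e^{G+2} + 2`. [folklore] -/
theorem K_le (n : ℕ) : (K n : ℝ) ≤ n * Real.exp (G n + 2) + 2 := by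
  unfold K; push_cast
  have := Nat.ceil_lt_add_one (show 0 ≤ (n : ℝ) * Real.exp (G n + 2) by positivity)
  linarith

/-- `1 ≤ K·N`. [folklore] -/
theorem one_le_KN : 1 ≤ K n * P.N := Nat.mul_pos (one_le_K n) P.hN

/-! ### The depth -/

/-- `2^{Ŝ} ≤ 2^{n+24} · K · N`. [cite: Nesterenko2003, (5.6)] -/
theorem two_pow_Sd_le : 2 ^ P.Sd ≤ 2 ^ (n + 24) * (K n * P.N) := by
  have h : 2 ^ Nat.log 2 (K n * P.N) ≤ K n * P.N :=
    Nat.pow_log_le_self 2 (Nat.one_le_iff_ne_zero.mp P.one_le_KN)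
  have e : 2 ^ P.Sd = 2 ^ (n + 24) * 2 ^ Nat.log 2 (K n * P.N) := by unfold Sd; rw [← pow_add]
  rw [e]; exact Nat.mul_le_mul_left _ h

/-- `2^{n+23} · K · N < 2^{Ŝ}`. [folklore] -/
theorem lt_two_pow_Sd : 2 ^ (n + 23) * (K n * P.N) < 2 ^ P.Sd := by
  have h := Nat.lt_pow_succ_log_self (b := 2) (by norm_num) (K n * P.N)
  have e : 2 ^ P.Sd = 2 ^ (n + 24) * 2 ^ Nat.log 2 (K n * P.N) := by unfold Sd; rw [← pow_add]
  rw [e]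
  calc 2 ^ (n + 23) * (K n * P.N) < 2 ^ (n + 23) * 2 ^ (Nat.log 2 (K n * P.N) + 1) :=
        Nat.mul_lt_mul_of_pos_left h (Nat.two_pow_pos _)
    _ = 2 ^ (n + 24) * 2 ^ Nat.log 2 (K n * P.N) := by ring

/-- `ŜK ≤ Ŝ`. [folklore] -/
theorem SdK_le_Sd : SdK n ≤ P.Sd := by
  unfold SdK Sd
  have : Nat.log 2 (K n) ≤ Nat.log 2 (K n * P.N) := Nat.log_mono_right (Nat.le_mul_of_pos_right _ P.hN)
  omega

/-- `Ŝ ≤ ŜK + ⌊log₂ N⌋ + 1`. [folklore] -/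
theorem Sd_le : P.Sd ≤ SdK n + Nat.log 2 P.N + 1 := by
  unfold SdK Sd
  have h1 : K n < 2 ^ (Nat.log 2 (K n) + 1) := Nat.lt_pow_succ_log_self one_lt_two _
  have h2 : P.N < 2 ^ (Nat.log 2 P.N + 1) := Nat.lt_pow_succ_log_self one_lt_two _
  have h3 : K n * P.N < 2 ^ (Nat.log 2 (K n) + Nat.log 2 P.N + 1 + 1) := by
    calc K n * P.N ≤ K n * 2 ^ (Nat.log 2 P.N + 1) := Nat.mul_le_mul_left _ h2.le
      _ < 2 ^ (Nat.log 2 (K n) + 1) * 2 ^ (Nat.log 2 P.N + 1) :=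
          Nat.mul_lt_mul_of_pos_right h1 (Nat.two_pow_pos _)
      _ = 2 ^ (Nat.log 2 (K n) + Nat.log 2 P.N + 1 + 1) := by rw [← pow_add]; ring_nf
  have := Nat.lt_succ_iff.1 (Nat.log_lt_of_lt_pow' (by omega) h3)
  omega

/-- `n + 24 ≤ Ŝ`. [folklore] -/
theorem le_Sd : n + 24 ≤ P.Sd := by unfold Sd; omega

/-- `yloadK ≤ yload`. [folklore] -/
theorem yloadK_le_yload : yloadK n ≤ P.yload := by
  unfold yloadK yload
  have h : (SdK n : ℝ) ≤ P.Sd := by exact_mod_cast P.SdK_le_Sd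
  have hl : 0 < Real.log 2 := Real.log_pos one_lt_two
  nlinarith

/-- `G ≤ yloadK` and indeed `2G ≤ yloadK`. [folklore] -/
theorem two_G_le_yloadK (n : ℕ) : 2 * G n ≤ yloadK n := by
  unfold yloadK
  have hl : 0 ≤ Real.log 2 := Real.log_nonneg one_le_two
  have hn : 0 ≤ Real.log ((n : ℝ) + 1) := Real.log_nonneg (by have : (0:ℝ) ≤ n := Nat.cast_nonneg n; linarith)
  have hS : (0 : ℝ) ≤ SdK n := Nat.cast_nonneg _
  have hn0 : (0 : ℝ) ≤ n := Nat.cast_nonneg n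
  nlinarith

/-- `0 < yloadK`. [folklore] -/
theorem yloadK_pos (n : ℕ) : 0 < yloadK n := by linarith [two_G_le_yloadK n, G_pos n]

/-! ### The scale `L` and its floors -/

/-- the Siegel term: `24 C_bⁿ Ω K·yloadK/G ≤ L`. [folklore] -/
theorem main_le_L : 24 * Cb ^ n * P.Ω * K n * yloadK n / G n ≤ P.L := by
  have h : (⌈24 * Cb ^ n * P.Ω * K n * yloadK n / G n⌉₊ : ℝ) ≤ P.L := by
    unfold L; exact_mod_cast le_trans (le_max_left _ _) (le_max_left _ _)
  exact (Nat.le_ceil _).trans h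

/-- `2^{n+25} ≤ L`. [folklore] -/
theorem two_pow_le_L : 2 ^ (n + 25) ≤ P.L := by
  unfold L; exact le_trans (le_max_right _ _) (le_max_left _ _)

/-- `1 ≤ L` and `0 < L` (real). [folklore] -/
theorem L_real_facts : (1 : ℝ) ≤ P.L ∧ (0 : ℝ) < P.L := by
  have h : 1 ≤ P.L := le_trans Nat.one_le_two_pow P.two_pow_le_L
  have h' : (1 : ℝ) ≤ P.L := by exact_mod_cast h
  exact ⟨h', lt_of_lt_of_le one_pos h'⟩

/-- `2 Amax + 1 ≤ L`. [folklore] -/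
theorem two_Amax_add_one_le_L : 2 * P.Amax + 1 ≤ P.L := by
  have h : (⌈2 * P.Amax + 1⌉₊ : ℝ) ≤ P.L := by
    unfold L; exact_mod_cast le_trans (le_max_left _ _) (le_max_right _ _)
  exact (Nat.le_ceil _).trans h

/-- `4(Ŝ + 2) ≤ L`. [folklore] -/
theorem four_Sd_le_L : 4 * (P.Sd + 2) ≤ P.L := by
  unfold L; exact le_trans (le_max_right _ _) (le_max_right _ _)

/-- **`24 C_bⁿ Ω K ≤ L`** (as `yloadK ≥ 2G`). [cite: Nesterenko2003, §3.5 (3.23)] -/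
theorem core_le_L : 24 * Cb ^ n * P.Ω * K n ≤ P.L := by
  have h := P.main_le_L
  have hG := G_pos n
  have hy : 2 ≤ yloadK n / G n := by rw [le_div_iff₀ hG]; linarith [two_G_le_yloadK n]
  have hc : 0 ≤ 24 * Cb ^ n * P.Ω * K n := by
    have := P.Ω_pos; have := K_pos n; have := Cb_pos; positivity
  calc 24 * Cb ^ n * P.Ω * K n ≤ 24 * Cb ^ n * P.Ω * K n * (yloadK n / G n) := by nlinarith
    _ = 24 * Cb ^ n * P.Ω * K n * yloadK n / G n := by ring
    _ ≤ P.L := h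


/-! ### v2 — the per-derivative unit `WN = W + log N` and the `X`-chain WITHOUT `log L` (cell lit FINDING #4 / SPEC §18)

The v1 closed forms `WL = log(e(1 + 2e^W L))` (`⊇ log L ⊇ log Ω`) inside `X`, and the field `hNW : log N ≤ W`, put
`Ω·log Ω`-sized terms next to `log(eB)`; the crux `ArchCoreRat` (`−c^r·Ω·log(eB)`) has no slot for them (in the `p`-adic
texts the `log(2A_max)` slot absorbs them). PRINT pays the per-derivative cost as `log(eBN) + O(1)` by normalising the Taylor
jets with the constant `c = eBN` and charging the one-off factor `e^{y/(eBN)} ≤ e^{4nL/e}` to the degree budget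
[Nesterenko2003, §4.2 (4.20)–(4.23)]; in lp-1's `ArchG3KStepDelta.kstep_delta_symm/odd` this is the free jets scale `C`
(`log C := WN + O(1)`, one-off `e^{ΣAₖΓₖ/C}`). The v2 chain below (`WN, XN, XsN, L0N, HN, D0N, XfinN, ZN, zerosN`) is the one
the record's budget lines use; `WL, X, Xs, L₀, H, D₀, Xfin, Z, zeros` above are DEPRECATED (kept by the append-only rule), and
`hNW` is VESTIGIAL: the certified mode is `N = 1` (the Kummer-conditional core, where `hNW` is `0 ≤ W`), headline
`ZN ≍ Ω·K·yload_K·W = C(n)·Ω·W`; for general `N` the honest headline is `C(n)·Ω·(W + log N)` — print's one-stage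
`𝔑`-threading balances the degrees by `log(eB)/log(eBN)` [Nesterenko2003, (3.23)] and counts `𝔑`-points in thin boxes
(Prop. 3.4), which is NOT this file. Kit: HOME/p1/num/g10/arch_table_v2.md (j284859/j284860). -/

/-- v2: the per-derivative cost unit **`WN = W + log N`** (`log(eBN) + O(1)`; NO `log L`).
[cite: Nesterenko2003, §3.5 (3.23) and §4.2 (4.20)–(4.23)] -/
def WN : ℝ := P.W + Real.log P.N

/-- v2: the number of points `XN = max(⌈64(n+1)·WN/G⌉, ⌈(3/2)(n+1)L/(C_bⁿΩK)⌉, 64(n+1))` (`≍ (9.9n+17.8)·log(eBN)` in print).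
[cite: Nesterenko2003, Prop 3.9 (3.25)] -/
def XN : ℕ :=
  max (max ⌈64 * (n + 1) * P.WN / G n⌉₊ ⌈(3 / 2) * (n + 1) * P.L / (Cb ^ n * P.Ω * K n)⌉₊) (64 * (n + 1))

/-- v2: the range at level `s`: `XsN s = ⌊2^s G·XN/(16(n+1))⌋ + 1`. [cite: Nesterenko2003, (4.3)] -/
def XsN (s : ℕ) : ℕ := ⌊(2 : ℝ) ^ s * G n * P.XN / (16 * (n + 1))⌋₊ + 1

/-- v2: the `Y₀`-degree `L0N = ⌈6·XN·C_bⁿ Ω K/N⌉` (Siegel over `𝔑`). [cite: Nesterenko2003, (3.23)] -/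
def L0N : ℕ := ⌈6 * P.XN * Cb ^ n * P.Ω * K n / P.N⌉₊

/-- v2: the Feldman block `HN = max 1 ⌊G·XN/(64(n+1))⌋`. [cite: Nesterenko2003, (3.23)] -/
def HN : ℕ := max 1 ⌊G n * P.XN / (64 * (n + 1))⌋₊

/-- v2: `D0N = L0N + 1`. [cite: Nesterenko2003, §5.2] -/
def D0N : ℕ := P.L0N + 1

/-- v2: the END range `XfinN = 2ⁿ·XsN Ŝ/(n+1)`. [cite: Nesterenko2003, §5.2 (5.12)] -/
def XfinN : ℕ := 2 ^ n * P.XsN P.Sd / (n + 1)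

/-- v2: the unit `ZN = G·(XN·L)`. [folklore] -/
def ZN : ℝ := G n * (P.XN * P.L)

/-- v2: the zeros gain at stage `(s, ν)`: `G·(2^{ν+1}XsN s)·(T_s+1)`. [cite: Nesterenko2003, (4.25)] -/
def zerosN (s ν : ℕ) : ℝ := G n * (2 ^ (ν + 1) * P.XsN s) * (P.T s + 1)

/-- `W ≤ WN` and `1 ≤ WN` (`log N ≥ 0`). [folklore] -/
theorem WN_facts : P.W ≤ P.WN ∧ 1 ≤ P.WN := by
  have h : 0 ≤ Real.log (P.N : ℝ) := Real.log_nonneg (by exact_mod_cast P.hN)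
  have := P.hW
  unfold WN
  exact ⟨by linarith, by linarith⟩

/-- At `N = 1` the unit is `W` itself: `WN = W`. [folklore] -/
theorem WN_eq_of_N_eq_one (h1 : P.N = 1) : P.WN = P.W := by
  unfold WN; rw [h1]; simp


end ArchG3Par

end Summit.ABC.StewartYu
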